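import Literature.Computability.AlgebraicComplexity.CwCubeDeadLabels
import Literature.Computability.AlgebraicComplexity.PackedRowLUCertificate
import Literature.Computability.AlgebraicComplexity.BorderRankCWKoszul
import Literature.Computability.AlgebraicComplexity.BorderRankCWKoszulRanksCubeTwoProofs
import HarnessLib

/-!
# The `q = 5` base blocks of the cube: entries, candidate columns and the certificate bridge

Topic: `Literature/Computability/AlgebraicComplexity`.  Third step of the `q`-uniform proof of the
cube case of Conner–Gesmundo–Landsberg–Ventura 2022, Thm. 1.2 (`CGLV2022_thm12_cube`): by
`CwCubeDeadLabels.lean`, for every `q ≥ 5` the `p = 2` Koszul flattening of `T_{cw,q}^{⊠3}` after the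
restriction `extendPhi 5 q φ₃|₅` (CGLV's `φ₃` of Thm. 3.4 at `q = 5`, `cglvPhi3 _ 5`, extended by zero)
has rank at least `r_∅ + (q-5)(r_0+r_1+r_2) + (q-5)²(r_01+r_02+r_12) + (q-5)³ r_012` — with the eight
block ranks `r_F = blockRank 2 (cglvPhi3 ℂ 5) F` of the single `2160 × 2160` integer matrix
`K₅ = K(φ₃|₅, T_{cw,5}^{⊠3})` frozen on the dead set `F ⊆ {0,1,2}`.  This file provides the MACHINERY
with which those ranks are certified (by packed row-sparse LU certificates modulo `3`,
`PackedRowLUCertificate.lean`) and the bridge from a passing certificate to a bound on `blockRank`;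
it contains no certificate and proves no rank bound itself:

* `K5.lab`, `K5.tiOf`, `K5.decR`, `K5.decC` — row/column codes `216·t + 36x₀ + 6x₁ + x₂`
  (`t < 10` the index of the `Λ`-part in `dec3`/`dec2`, `x ∈ {0,…,5}³` the label).
* `K5.K5Z`, `K5.koszulFlattening_five_complex` — `K₅` over `ℤ` and its base change to the complex
  flattening of the decomposition.
* `K5.phiTab`, `K5.phiCode`, `K5.phiCode_spec` — `φ₃|₅` packed (2 bits per entry, `decide`d against
  `cglvPhi3 ℤ 5`); `K5.entFin`, `K5.entFin_eq`, `K5.entNat`, `K5.entNat_eq` — the entries of `K₅`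
  modulo `pr` as a kernel-cheap function (incidence numeral of
  `BorderRankCWKoszulRanksCubeTwoProofs.lean`, factorwise `cwAlpha` / `alphaNat`).
* `K5.suppTab`, `K5.pairTab`, `K5.solveDigit`, `K5.solveCol`, `K5.candFin`, `K5.mem_candFin` —
  the candidate columns of a row `(T, c)` (at most `45`): `T = S ∪ {j}`, a label `a` in the
  support of row `j` of `φ₃|₅`, and factorwise the unique `b_l` with `α(b_l, c_l) = a_l`
  (complete by `exists_of_koszulFlattening_cwPow_ne_zero`).
* `K5.ent`, `K5.cand`, `K5.colOK`, `K5.blockZ`, `K5.ent_eq_blockZ`, `K5.mem_cand_of_blockZ_ne_zero`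
  — the same on codes, frozen on `F`: the `hent` / `hcand` arguments of `RowLU.le_rank_of_checksP`
  for the matrix `K₅^ℤ[fixRow F, fixCol F]`.
* `K5.blockRank_ge` — **the bridge**: if `RowLU.globalCheck` and all `RowLU.rowCheckP` pass for a
  certificate `C`, then `C.k ≤ blockRank 2 (cglvPhi3 ℂ 5) F`.
* NOT here: the certificates and the eight bounds — `CwCubeKoszulCertBlocks.lean` (`|F| ≥ 1`:
  `K5.certF…`, `K5.blockRank_F…_ge`, ranks `294, 294, 294, 42, 42, 42, 6`) and
  `CwCubeKoszulCertMain.lean` (`F = ∅`: `K5.certE`, `K5.blockRank_E_ge`, rank `2058`); the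
  assembly and the discharge of `CGLV2022_thm12_cube` — `BorderRankCWThm12Cube.lean`.

## References

* A. Conner, F. Gesmundo, J. M. Landsberg, E. Ventura, *Rank and border rank of Kronecker powers of
  tensors and Strassen's laser method*, comput. complexity 31 (2022) = arXiv:1909.04785v2, Thm. 3.4
  and its proof (`φ₃`; the ranks `2058, 294, 42, 6`), §6. [ConnerGesmundoLandsbergVentura2022]
-/

open scoped BigOperators
open Matrix

namespace Literature.Computability.AlgebraicComplexity

namespace K5

/-! ## Codes -/

/-- The label `x ∈ {0,…,5}³` of a code `216 t + 36 x₀ + 6 x₁ + x₂`. [folklore] -/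
def lab (a : ℕ) : Fin 3 → Fin 6 :=
  ![⟨a / 36 % 6, Nat.mod_lt _ (by decide)⟩, ⟨a / 6 % 6, Nat.mod_lt _ (by decide)⟩,
    ⟨a % 6, Nat.mod_lt _ (by decide)⟩]

/-- The `Λ`-part index `t < 10` of a code. [folklore] -/
def tiOf (a : ℕ) : Fin 10 := ⟨a / 216 % 10, Nat.mod_lt _ (by decide)⟩

/-- The row of `K₅` with code `a`, frozen on `F`. [folklore] -/
def decR (F : Fin 3 → Bool) (a : ℕ) : PSub 5 3 × (Fin 3 → Fin 6) := (dec3 (tiOf a), fixLab F (lab a))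

/-- The column of `K₅` with code `b`, frozen on `F`. [folklore] -/
def decC (F : Fin 3 → Bool) (b : ℕ) : PSub 5 2 × (Fin 3 → Fin 6) := (dec2 (tiOf b), fixLab F (lab b))

/-- The code of a label. [folklore] -/
def labCode (x : Fin 3 → Fin 6) : ℕ := 36 * (x 0).val + 6 * (x 1).val + (x 2).val

/-! ## The integer matrix `K₅` and its base change -/

/-- `K₅ = K(φ₃|₅, T_{cw,5}^{⊠3})` over `ℤ` (`p = 2`). [cite: ConnerGesmundoLandsbergVentura2022, Thm. 3.4 (proof)] -/
noncomputable def K5Z : Matrix (PSub 5 3 × (Fin 3 → Fin 6)) (PSub 5 2 × (Fin 3 → Fin 6)) ℤ :=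
  koszulFlattening 2 (cglvPhi3 ℤ 5).mulVecLin (kroneckerPow (cwTensor ℤ 5) 3)

/-- `φ₃` has integer entries: its integer version base-changes to any commutative ring.
[cite: ConnerGesmundoLandsbergVentura2022, Thm. 3.4 (proof)] -/
theorem cglvPhi3_map_intCast (K : Type*) [CommRing K] (q : ℕ) :
    (cglvPhi3 ℤ q).map (Int.castRingHom K) = cglvPhi3 K q := by
  ext e x
  simp only [cglvPhi3, Matrix.map_apply, Matrix.of_apply]
  split_ifs <;> simp

/-- The complex flattening of the fact is the base change of `K₅`.
[cite: ConnerGesmundoLandsbergVentura2022, Thm. 3.4 (proof)] -/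
theorem koszulFlattening_five_complex :
    koszulFlattening 2 (cglvPhi3 ℂ 5).mulVecLin (kroneckerPow (cwTensor ℂ 5) 3) =
      K5Z.map (Int.castRingHom ℂ) := by
  rw [K5Z, ← koszulFlattening_cwPow_intCast, cglvPhi3_map_intCast]

/-! ## Entries of `K₅` modulo `pr`, fast -/

/-- `φ₃|₅` packed: 2 bits at index `216 j + (36 a₀ + 6 a₁ + a₂)`, `0 ↦ 0`, `1 ↦ 1`, `2 ↦ -1`.
[cite: ConnerGesmundoLandsbergVentura2022, Thm. 3.4 (proof)] -/
def phiTab : ℕ := 101974490653789348112824507434838940227691892466847043302268083535898667636141242235515469636596497354169208464627225570926001675371012078342436777951841922642561712744470598197827542829480762201649009615975192203283176771165367336974393795694721017089935693284459953483377970742203446169404650771006490367434163476097505820793196714814464885233288812032301544611352868517937635435838165614022784412019327425879442742213168350959190193763139467489648783329425385903011470266453710455822091988495943733450733112871629742739833616164478461759183300151420290436329072547571044999001641320449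

/-- The packed code of `(φ₃|₅)_{j, a}`. [folklore] -/
def phiCode (j : Fin 5) (a : Fin 3 → Fin 6) : ℕ := RowLU.getW phiTab 2 (216 * j.val + labCode a)

/-- Decoding of a packed `φ` code to an integer. [folklore] -/
def phiDecode (d : ℕ) : ℤ := if d = 0 then 0 else if d = 1 then 1 else -1

/-- The packed table is `φ₃|₅`. [cite: ConnerGesmundoLandsbergVentura2022, Thm. 3.4 (proof)] -/
theorem phiCode_spec : ∀ (j : Fin 5) (a : Fin 3 → Fin 6), phiDecode (phiCode j a) = cglvPhi3 ℤ 5 j a := by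
  decide +kernel

/-- The residue modulo `pr` of `± (decoded φ code)`. [folklore] -/
def resOf (pr d : ℕ) (pos : Bool) : ℕ :=
  if d = 0 then 0 else if decide (d = 1) = pos then 1 % pr else (pr - 1) % pr

/-- `resOf` computes `± φ` modulo `pr`. [folklore] -/
theorem resOf_cast (pr : ℕ) [NeZero pr] (d : ℕ) (pos : Bool) :
    ((resOf pr d pos : ℕ) : ZMod pr) = ((cond pos (phiDecode d) (-phiDecode d) : ℤ) : ZMod pr) := by
  have hm1 : ((pr - 1 : ℕ) : ZMod pr) = -1 := by
    rcases Nat.exists_eq_succ_of_ne_zero (NeZero.ne pr) with ⟨n, rfl⟩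
    rw [Nat.succ_sub_one, eq_neg_iff_add_eq_zero, ← Nat.cast_succ, ZMod.natCast_self]
  unfold resOf phiDecode
  by_cases h0 : d = 0
  · subst h0
    cases pos <;> simp
  · by_cases h1 : d = 1
    · subst h1
      cases pos
      · simp [hm1]
      · simp [ZMod.natCast_mod]
    · cases pos
      · simp [h0, h1, ZMod.natCast_mod]
      · simp [h0, h1, hm1]

/-- **The entries of `K₅` modulo `pr`, fast**: row `(dec3 ti, c)`, column `(dec2 si, b)`.
[cite: ConnerGesmundoLandsbergVentura2022, Thm. 3.4 (proof)] -/
def entFin (pr : ℕ) (ti : Fin 10) (c : Fin 3 → Fin 6) (si : Fin 10) (b : Fin 3 → Fin 6) : ℕ :=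
  match CwCubeTwoCert.incDecode (CwCubeTwoCert.incDigit ti.val si.val) with
  | none => 0
  | some (j, pos) =>
    match cwAlphaPow 5 3 b c with
    | none => 0
    | some a => resOf pr (phiCode j a) pos

/-- `entFin` computes the entries of `K₅` modulo `pr`. [cite: ConnerGesmundoLandsbergVentura2022, Thm. 3.4 (proof)] -/
theorem entFin_eq (pr : ℕ) [NeZero pr] (ti : Fin 10) (c : Fin 3 → Fin 6) (si : Fin 10)
    (b : Fin 3 → Fin 6) :
    ((entFin pr ti c si b : ℕ) : ZMod pr) = ((K5Z (dec3 ti, c) (dec2 si, b) : ℤ) : ZMod pr) := by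
  have hK : K5Z (dec3 ti, c) (dec2 si, b) =
      cwCubeSelEntry (cwCubeIncIdx ti si) fun j => powPhiVal (cglvPhi3 ℤ 5) j b c := by
    rw [K5Z, koszulFlattening_cwPow_apply]
    dsimp only
    simp_rw [Int.cast_id, cwCubeIncIdx_spec ti si]
    unfold cwCubeSelEntry
    rcases cwCubeIncIdx ti si with _ | ⟨j, s⟩
    · simp [cwCubeIncSel]
    · simp only [cwCubeIncSel, ite_mul, zero_mul]
      rw [Finset.sum_ite_eq']
      cases s <;> simp
  rw [hK, entFin, CwCubeTwoCert.incDecode_incDigit]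
  rcases cwCubeIncIdx ti si with _ | ⟨j, pos⟩
  · simp [cwCubeSelEntry]
  · dsimp only [cwCubeSelEntry]
    rcases h : cwAlphaPow 5 3 b c with _ | a
    · rw [powPhiVal_of_none _ _ h]
      cases pos <;> simp
    · rw [powPhiVal_of_some _ _ h, resOf_cast, phiCode_spec]

/-! ## The same entries on raw digits (no `Fin`, no instances: the form the kernel evaluates) -/

/-- `α(x, y)` on label values, `6` encoding "undefined". [cite: ConnerGesmundoLandsbergVentura2022, eq. (1)] -/
def alphaNat (x y : ℕ) : ℕ :=
  bif x == y then (bif x == 0 then 6 else 0) else bif x == 0 then y else bif y == 0 then x else 6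

/-- `alphaNat` computes `cwAlpha 5`. [cite: ConnerGesmundoLandsbergVentura2022, eq. (1)] -/
theorem alphaNat_spec : ∀ x y : Fin 6,
    (cwAlpha 5 x y = none → alphaNat x.val y.val = 6) ∧
      ∀ a : Fin 6, cwAlpha 5 x y = some a → alphaNat x.val y.val = a.val := by
  decide

/-- A frozen digit: `5` if frozen, else the digit. [folklore] -/
def fz (f : Bool) (x : ℕ) : ℕ := bif f then 5 else x

/-- **The entries of the frozen `K₅` modulo `pr` on raw codes** (the function the kernel runs):
`f₀ f₁ f₂` the dead set, `a` the row code, `b` the column code. [cite: ConnerGesmundoLandsbergVentura2022, Thm. 3.4 (proof)] -/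
def entNat (pr : ℕ) (f₀ f₁ f₂ : Bool) (a b : ℕ) : ℕ :=
  match CwCubeTwoCert.incDigit (a / 216 % 10) (b / 216 % 10) with
  | 0 => 0
  | d + 1 =>
    match alphaNat (fz f₀ (b / 36 % 6)) (fz f₀ (a / 36 % 6)), alphaNat (fz f₁ (b / 6 % 6)) (fz f₁ (a / 6 % 6)),
      alphaNat (fz f₂ (b % 6)) (fz f₂ (a % 6)) with
    | α₀, α₁, α₂ =>
      bif (α₀ == 6 || α₁ == 6 || α₂ == 6) then 0
      else resOf pr (RowLU.getW phiTab 2 (216 * (d / 2 % 5) + (36 * α₀ + 6 * α₁ + α₂))) (d % 2 == 1)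

/-! ## Candidate columns (the support of a row, by the support of `φ₃|₅`) -/

/-- The support of row `j` of `φ₃|₅`, as label codes. [cite: ConnerGesmundoLandsbergVentura2022, Thm. 3.4 (proof)] -/
def suppTab (j : ℕ) : List ℕ :=
  if j = 0 then [0] else if j = 1 then [1, 2, 3, 4, 5, 6, 12, 18, 24, 30, 36, 72, 108, 144, 180] else if j = 2 then [1, 6, 8, 38, 42, 49, 72, 79] else if j = 3 then [14, 18, 19, 36, 39, 48, 78, 80, 108] else [2, 4, 7, 10, 12, 15, 20, 24, 36, 50, 84, 111]

/-- Completeness of `suppTab`. [cite: ConnerGesmundoLandsbergVentura2022, Thm. 3.4 (proof)] -/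
theorem mem_suppTab : ∀ (j : Fin 5) (a : Fin 3 → Fin 6), cglvPhi3 ℤ 5 j a ≠ 0 → labCode a ∈ suppTab j.val := by
  decide +kernel

/-- The `B`-label `b` with `α(b, c) = a` in one factor, if any (`6` = none): `a = 0` needs `c ≠ 0`
and gives `b = c`; `a ≠ 0` gives `b = a` if `c = 0`, `b = 0` if `c = a`.
[cite: ConnerGesmundoLandsbergVentura2022, eq. (1)] -/
def solveDigit (x y : ℕ) : ℕ :=
  bif x == 0 then (bif y == 0 then 6 else y) else bif y == 0 then x else bif y == x then 0 else 6

/-- `solveDigit` inverts `cwAlpha 5`. [cite: ConnerGesmundoLandsbergVentura2022, eq. (1)] -/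
theorem solveDigit_spec : ∀ b c a : Fin 6, cwAlpha 5 b c = some a → solveDigit a.val c.val = b.val := by
  decide

/-- The pairs `(si, j)` with `dec3 ti = dec2 si ∪ {j}`. [folklore] -/
def pairTab (ti : ℕ) : List (ℕ × ℕ) :=
  if ti = 0 then [(4, 0), (1, 1), (0, 2)]
  else if ti = 1 then [(5, 0), (2, 1), (0, 3)]
  else if ti = 2 then [(6, 0), (3, 1), (0, 4)]
  else if ti = 3 then [(7, 0), (2, 2), (1, 3)]
  else if ti = 4 then [(8, 0), (3, 2), (1, 4)]
  else if ti = 5 then [(9, 0), (3, 3), (2, 4)]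
  else if ti = 6 then [(7, 1), (5, 2), (4, 3)]
  else if ti = 7 then [(8, 1), (6, 2), (4, 4)]
  else if ti = 8 then [(9, 1), (6, 3), (5, 4)]
  else [(9, 2), (8, 3), (7, 4)]

/-- Completeness of `pairTab`. [folklore] -/
theorem mem_pairTab : ∀ (ti si : Fin 10) (j : Fin 5),
    (j ∉ (dec2 si).1 ∧ (dec3 ti).1 = insert j (dec2 si).1) → (si.val, j.val) ∈ pairTab ti.val := by
  decide

/-- The column code solved from a pair `(si, j)`, a label code `acode` in the support of row `j`,
and the row label `c` (`none` if some factor is incompatible). [folklore] -/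
def solveCol (c : Fin 3 → Fin 6) (si acode : ℕ) : Option ℕ :=
  match solveDigit (acode / 36) (c 0).val, solveDigit (acode / 6 % 6) (c 1).val,
    solveDigit (acode % 6) (c 2).val with
  | b₀, b₁, b₂ =>
    bif (b₀ == 6 || b₁ == 6 || b₂ == 6) then none else some (216 * si + (36 * b₀ + 6 * b₁ + b₂))

/-- **The candidate columns** of the row `(dec3 ti, c)`, as codes: at most `3 · 15` of them.
[cite: ConnerGesmundoLandsbergVentura2022, Thm. 3.4 (proof)] -/
def candFin (ti : Fin 10) (c : Fin 3 → Fin 6) : List ℕ :=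
  (pairTab ti.val).flatMap fun p => (suppTab p.2).filterMap fun acode => solveCol c p.1 acode

/-- **Completeness of the candidates**: a non-zero entry of `K₅` in row `(dec3 ti, c)` lies in a
column `(dec2 si, b)` whose code is a candidate. [cite: ConnerGesmundoLandsbergVentura2022, Thm. 3.4 (proof)] -/
theorem mem_candFin (ti : Fin 10) (c : Fin 3 → Fin 6) (si : Fin 10) (b : Fin 3 → Fin 6)
    (h : K5Z (dec3 ti, c) (dec2 si, b) ≠ 0) : 216 * si.val + labCode b ∈ candFin ti c := by
  obtain ⟨j, a, hj, hT, ha, hM⟩ := exists_of_koszulFlattening_cwPow_ne_zero 2 _ _ _ h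
  have hpair : (si.val, j.val) ∈ pairTab ti.val := mem_pairTab ti si j ⟨hj, hT⟩
  have hsupp : labCode a ∈ suppTab j.val := mem_suppTab j a hM
  rw [cwAlphaPow_eq_some_iff] at ha
  have hs : ∀ l, solveDigit (a l).val (c l).val = (b l).val := fun l => solveDigit_spec _ _ _ (ha l)
  have h0 : labCode a / 36 = (a 0).val := by
    have := (a 0).isLt; have := (a 1).isLt; have := (a 2).isLt; unfold labCode; omega
  have h1 : labCode a / 6 % 6 = (a 1).val := by
    have := (a 0).isLt; have := (a 1).isLt; have := (a 2).isLt; unfold labCode; omega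
  have h2 : labCode a % 6 = (a 2).val := by
    have := (a 0).isLt; have := (a 1).isLt; have := (a 2).isLt; unfold labCode; omega
  have hcol : solveCol c si.val (labCode a) = some (216 * si.val + labCode b) := by
    unfold solveCol
    rw [h0, h1, h2, hs 0, hs 1, hs 2]
    have hne : ∀ l, ((b l).val == 6) = false := fun l => beq_false_of_ne (Nat.ne_of_lt (b l).isLt)
    simp only [hne, Bool.or_false, cond_false]
    rfl
  unfold candFin
  simp only [List.mem_flatMap, List.mem_filterMap]
  exact ⟨(si.val, j.val), hpair, labCode a, hsupp, hcol⟩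

/-! ## On codes, frozen on a dead set `F` -/

section Frozen

variable (pr : ℕ) (F : Fin 3 → Bool)

/-- The entry function on codes for the frozen matrix `K₅[fixRow F, fixCol F]`. [folklore] -/
def ent (a b : ℕ) : ℕ := entFin pr (tiOf a) (fixLab F (lab a)) (tiOf b) (fixLab F (lab b))

/-- The raw-digit entry function is `ent`. [folklore] -/
theorem entNat_eq (a b : ℕ) : entNat pr (F 0) (F 1) (F 2) a b = ent pr F a b := by
  have hdig : ∀ (l : Fin 3) (x : ℕ), (fixLab F (lab x) l).val = fz (F l) (lab x l).val := by
    intro l x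
    unfold fixLab fz
    cases F l <;> simp
  have e0 : alphaNat (fz (F 0) (b / 36 % 6)) (fz (F 0) (a / 36 % 6)) =
      alphaNat (fixLab F (lab b) 0).val (fixLab F (lab a) 0).val := by rw [hdig, hdig]; rfl
  have e1 : alphaNat (fz (F 1) (b / 6 % 6)) (fz (F 1) (a / 6 % 6)) =
      alphaNat (fixLab F (lab b) 1).val (fixLab F (lab a) 1).val := by rw [hdig, hdig]; rfl
  have e2 : alphaNat (fz (F 2) (b % 6)) (fz (F 2) (a % 6)) =
      alphaNat (fixLab F (lab b) 2).val (fixLab F (lab a) 2).val := by rw [hdig, hdig]; rfl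
  unfold ent entFin entNat
  change _ = (match CwCubeTwoCert.incDecode (CwCubeTwoCert.incDigit (a / 216 % 10) (b / 216 % 10)) with
    | none => 0
    | some (j, pos) =>
      match cwAlphaPow 5 3 (fixLab F (lab b)) (fixLab F (lab a)) with
      | none => 0
      | some a' => resOf pr (phiCode j a') pos)
  rcases CwCubeTwoCert.incDigit (a / 216 % 10) (b / 216 % 10) with _ | d
  · simp [CwCubeTwoCert.incDecode]
  · have hdec : CwCubeTwoCert.incDecode (d + 1) =
        some (⟨d / 2 % 5, Nat.mod_lt _ (by decide)⟩, d % 2 == 1) := by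
      simp [CwCubeTwoCert.incDecode]
    rw [hdec]
    dsimp only
    rcases hα : cwAlphaPow 5 3 (fixLab F (lab b)) (fixLab F (lab a)) with _ | α
    · obtain ⟨l, hnone⟩ := cwAlphaPow_eq_none_iff.1 hα
      have h3 : cwAlpha 5 (fixLab F (lab b) 0) (fixLab F (lab a) 0) = none ∨
          cwAlpha 5 (fixLab F (lab b) 1) (fixLab F (lab a) 1) = none ∨
          cwAlpha 5 (fixLab F (lab b) 2) (fixLab F (lab a) 2) = none := by
        fin_cases l
        · exact Or.inl hnone
        · exact Or.inr (Or.inl hnone)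
        · exact Or.inr (Or.inr hnone)
      rcases h3 with h | h | h
      · rw [e0, (alphaNat_spec _ _).1 h]
        rfl
      · rw [e1, (alphaNat_spec _ _).1 h]
        simp
      · rw [e2, (alphaNat_spec _ _).1 h]
        simp
    · have hs := cwAlphaPow_eq_some_iff.1 hα
      have h0 : alphaNat (fz (F 0) (b / 36 % 6)) (fz (F 0) (a / 36 % 6)) = (α 0).val := by
        rw [e0]; exact (alphaNat_spec _ _).2 _ (hs 0)
      have h1 : alphaNat (fz (F 1) (b / 6 % 6)) (fz (F 1) (a / 6 % 6)) = (α 1).val := by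
        rw [e1]; exact (alphaNat_spec _ _).2 _ (hs 1)
      have h2 : alphaNat (fz (F 2) (b % 6)) (fz (F 2) (a % 6)) = (α 2).val := by
        rw [e2]; exact (alphaNat_spec _ _).2 _ (hs 2)
      have hne : ∀ l, ((α l).val == 6) = false := fun l =>
        beq_false_of_ne (Nat.ne_of_lt (α l).isLt)
      simp only [h0, h1, h2, hne, Bool.or_false, cond_false]
      rfl

/-- The candidate function on codes for the frozen matrix. [folklore] -/
def cand (a : ℕ) : List ℕ := candFin (tiOf a) (fixLab F (lab a))

/-- Admissible column codes: `< 2160` and frozen on `F` (label `5` on the dead coordinates).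
[folklore] -/
def colOK (b : ℕ) : Bool :=
  decide (b < 2160) && decide (∀ l : Fin 3, F l = true → (lab b l).val = 5)

/-- The frozen integer matrix `K₅^ℤ[fixRow F, fixCol F]`; its base change to `ℂ` has rank
`blockRank 2 (cglvPhi3 ℂ 5) F` (see `blockRank_ge`). [folklore] -/
noncomputable def blockZ : Matrix (PSub 5 3 × (Fin 3 → Fin 6)) (PSub 5 2 × (Fin 3 → Fin 6)) ℤ :=
  K5Z.submatrix (fixRow 2 F) (fixCol 2 F)

variable {pr F}

/-- `ent` agrees with the frozen matrix modulo `pr` (the `hent` argument of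
`RowLU.le_rank_of_checksP`). [folklore] -/
theorem ent_eq_blockZ [NeZero pr] (a b : ℕ) :
    ((ent pr F a b : ℕ) : ZMod pr) = ((blockZ F (decR (fun _ => false) a) (decC (fun _ => false) b) : ℤ) : ZMod pr) := by
  rw [ent, entFin_eq]
  rfl

/-- A frozen code decodes to its frozen label. [folklore] -/
theorem fixLab_lab_of_colOK {b : ℕ} (hb : colOK F b = true) : fixLab F (lab b) = lab b := by
  simp only [colOK, Bool.and_eq_true, decide_eq_true_eq] at hb
  funext l
  unfold fixLab
  split_ifs with hl
  · exact Fin.ext (by rw [Fin.val_last, hb.2 l hl])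
  · rfl

/-- A code `< 2160` is the code of its parts. [folklore] -/
theorem code_eq_of_lt {b : ℕ} (hb : b < 2160) : 216 * (tiOf b).val + labCode (lab b) = b := by
  simp only [tiOf, labCode, lab, Matrix.cons_val_zero, Matrix.cons_val_one, Matrix.head_cons,
    Matrix.cons_val_two, Matrix.tail_cons]
  omega

/-- `cand` is complete on admissible columns of the frozen matrix (the `hcand` argument of
`RowLU.le_rank_of_checksP`). [folklore] -/
theorem mem_cand_of_blockZ_ne_zero (a b : ℕ) (hb : colOK F b = true)
    (h : blockZ F (decR (fun _ => false) a) (decC (fun _ => false) b) ≠ 0) : b ∈ cand F a := by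
  have hb' : b < 2160 := by
    simp only [colOK, Bool.and_eq_true, decide_eq_true_eq] at hb
    exact hb.1
  have h' : K5Z (dec3 (tiOf a), fixLab F (lab a)) (dec2 (tiOf b), lab b) ≠ 0 := by
    rw [← fixLab_lab_of_colOK hb]
    exact h
  have := mem_candFin _ _ _ _ h'
  rwa [code_eq_of_lt hb'] at this

/-- **The bridge**: if the global check and all (packed) row checks of a certificate pass for the
frozen data, then `k ≤ blockRank 2 (cglvPhi3 ℂ 5) F`. [cite: ConnerGesmundoLandsbergVentura2022, Thm. 3.4 (proof)] -/
theorem blockRank_ge [Fact pr.Prime] (hpr8 : pr < 2 ^ 8) (C : RowLU.Cert)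
    (hglob : RowLU.globalCheck C (colOK F) = true)
    (hrows : ∀ i < C.k, RowLU.rowCheckP pr (entNat pr (F 0) (F 1) (F 2)) (cand F) C i = true) :
    C.k ≤ blockRank 2 (cglvPhi3 ℂ 5) F := by
  have h := RowLU.le_rank_of_checksP (K := ℂ) (blockZ F) (decR fun _ => false) (decC fun _ => false)
    (ent := entNat pr (F 0) (F 1) (F 2)) (cand := cand F) (colOK := colOK F)
    (fun a b => by rw [entNat_eq]; exact ent_eq_blockZ a b)
    (fun a b hb hne => mem_cand_of_blockZ_ne_zero a b hb hne) hpr8 hglob hrows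
  unfold blockRank
  rw [koszulFlattening_five_complex]
  exact h.trans (le_of_eq (by rw [blockZ, Matrix.submatrix_map]))

end Frozen

end K5

end Literature.Computability.AlgebraicComplexity
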